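import Literature.MathematicalPhysics.QuantumFieldTheory.Balaban1983to89.B10Eq69Concrete

/-!
# `Balaban1983to89.B10Eq70Concrete` — T. Bałaban, *Ultraviolet stability of three-dimensional lattice pure gauge
# field theories*, Commun. Math. Phys. **102** (1985) 255–275 [Balaban1985UV3]: (69) p. 273 for the paper's groups
# `U(N)`, `SU(N) ⊂ M_N(ℂ)`, and (70) p. 273 ("Squaring both sides": `|V_j(∂p′) − 1|² < Σ_{x∈B^j(x₀)} L^{−j} Σ_{p⊂(p′)_x}
# |U_k(∂p) − 1|² + O(1)(g_jp(g_j))³ ≤ …`) up to the trace identity of (11), PROVED for the concrete average (43) of [4]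

statement-level skeleton of published theorems with citation tags; proofs where landed; nothing here is a claim
about the Yang–Mills mass gap

PDF held: `paper:balaban1985-cmp102-uv-stability-3d` (journal page = PDF page + 254); p. 273 (PDF 19) read from the
render `b2b-balaban-ref1/pages/1985-cmp102-uv-stability-3d/…-p019-x2.png` as an image.  "[4]" = [Balaban1985Averaging].

WHAT IS REPRODUCED (mega-formalization `lit-balaban`, Phase-2 proof seat `p29`).  Row `B10.Eq69`: the instances of
`B10Eq69Concrete.eq69_at`/`eq69_concrete` for the paper's groups — `eq69_unitaryUnits` (unitary group of a C⋆-algebra),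
`eq69_unitaryGroup` (`G = U(N) ⊂ M_N(ℂ)`, operator norm (19) of [4]), `eq69_specialUnitary` (`G = SU(N)`, one
`G`-dependent smallness `N·32(d+1)(d+4)L²α₀ < π`; Theorem 1 p. 257: "a semi-simple compact Lie group `G`").
Row `B10.Eq70`.  THE PRINTED TEXT (p. 273, verbatim): *"Squaring both sides of the above inequality and using (67)
yields `|V_j(∂p′) − 1|² < Σ_{x∈B^j(x₀)} L^{−j} Σ_{p⊂(p′)_x} |U_k(∂p) − 1|² + O(1)(g_jp(g_j))³ ≤ 2 Σ_{p⊂Δ′} L^j[1 −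
Re tr U_k(∂p)] + O(1)(g_jp(g_j))³`, (70) where `Δ′ = B^j(x₀) ∪ B^j(y₀) ∪ B^j(z₀) ∪ B^j(w₀)`."*  Here ((67) `Ū_k^j = V_j`
is a renaming), under the hypotheses of `B10Eq69Concrete.eq69_at`:
* `eq70_first_at` — `|Ū^j(∂p′) − 1|² ≤ Σ_{x∈B^j(x₀)} L^{(2−d)j} Σ_{p⊂(p′)_x} |U(∂p) − 1|² + (2α₀R + R²)`, `R = (16/3)C₀α₀²`:
  the printed weight `L^{−j}` is `L^{(2−d)j}` at `d = 3` (block weight `L^{−dj}` of (69) × the `L^{2j}` fine plaquettes of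
  a big plaquette, Cauchy–Schwarz twice: `transSum_sq_le`, tacit in print, cell GAPS C-B10-2), and the printed
  `O(1)(g_jp(g_j))³` is EXPLICIT: `2α₀R + R² = (32/3)C₀α₀³ + (256/9)C₀²α₀⁴`, `α₀ = O(1)g_jp(g_j)` the constant of (68)
  (`transSum_le_of_pdev`: the sum (69) is `≤ α₀`; squaring pattern = the tree's `B10.eq70_sq_step`);
* `transSumSq_le_region`, `eq70_region_at` — the COUNT behind the second inequality: each fine plaquette of `Δ′` lies
  in at most `L^{2j}` translates `(p′)_x`, so the first sum is `≤ L^{(4−d)j} Σ_{p⊂Δ′} |U(∂p) − 1|²` (print, `d = 3`: the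
  factor `L^j`; `regionSumSq` = the sum over the unit plaquettes in the orientation of `p′` contained in `Δ′`) — (70)
  up to the trace identity `|U − 1|² = 2[1 − Re tr U]` of (11);
* `eq70_first_unitaryGroup`, `eq70_first_specialUnitary` — the first inequality for `U(N)`, `SU(N)`.
MODEL NOTES.  (M1)–(M5) of `B10Eq69Concrete` apply verbatim (general `d`; identifications; (68) global on `ηℤ^d`;
`≤` for `<`; explicit constants).  (M6) NORM: `|·|` is the norm of the ambient complete normed algebra — for `M_N(ℂ)`
the operator norm (19) of [4] (scope `Matrix.Norms.L2Operator`), as in every B7/B10 file of the tree; the last step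
of (70), `|U − 1|² = 2[1 − Re tr U]`, is the trace normalization (11) p. 258 (row B10.Eq11, «normalized-HS reading»)
and is NOT made here (for the operator norm it holds with a factor `N`); (71) is not touched (`B10.eq71_arith`).
Unit `lit-balaban-p29` (Phase-2 proof seat p29, gen 4); HOME `run/shared/lean/pub/lit-balaban/`.
-/

noncomputable section

open scoped BigOperators
open NormedSpace Finset

namespace Literature.MathematicalPhysics.QuantumFieldTheory.Balaban1983to89.B10Eq70Concrete

open B7Prop1Explicit B7Prop2Explicit B7Prop2SpecialUnitary B7Eq50Linear B10Eq69Concrete MatrixLog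

export B7Prop1Explicit (Site) -- the `ℤ^d` sites (the torus `Site` of `Setup.lean` would shadow them)

variable {d : ℕ}

/-! ## §1 (69) for the paper's gauge groups: `U(N)` and `SU(N) ⊂ M_N(ℂ)` with the operator norm -/

/-- `2α₀ ≤ c₂′ = 1/(512(d+1)(d+4)L²)` gives the closure-radius smallness `32(d+1)(d+4)L²α₀ ≤ 1/4`. [folklore] -/
private theorem radius_quarter {L : ℕ} (hL : 2 ≤ L) {α₀ : ℝ} (hα2 : 2 * α₀ ≤ c2' d L) :
    32 * ((d : ℝ) + 1) * (d + 4) * (L : ℝ) ^ 2 * α₀ ≤ 1 / 4 := by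
  have hL1 : (1 : ℝ) ≤ L := by exact_mod_cast le_trans (by norm_num) hL
  have hpos : (0 : ℝ) < 512 * ((d : ℝ) + 1) * (d + 4) * (L : ℝ) ^ 2 := by positivity
  have h1 : 2 * α₀ ≤ 1 / (512 * ((d : ℝ) + 1) * (d + 4) * (L : ℝ) ^ 2) := hα2
  rw [le_div_iff₀ hpos] at h1
  linarith

section Unitary

variable {𝔸 : Type*} [CStarAlgebra 𝔸] [Nontrivial 𝔸]

/-- **B10 (69) for unitary configurations** (`G` = the unitary group of a non-trivial C⋆-algebra;
`B7Prop2Explicit.avgClosed_unitaryUnits`). [cite: Balaban1985UV3, (68)–(69) p.273] -/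
theorem eq69_unitaryUnits (L : ℕ) (hL : 2 ≤ L) (j : ℕ) (V : Site d → Fin d → 𝔸ˣ)
    (hV : ∀ x κ, V x κ ∈ unitaryUnits 𝔸) {α₀ : ℝ} (hα : 0 < α₀) (hα3 : C0 d * α₀ ≤ 1 / 3)
    (hα2 : 2 * α₀ ≤ c2' d L) (h68 : pdev V < α₀ * (((L : ℝ) ^ j)⁻¹) ^ 2) (z : Site d) {μ ν : Fin d}
    (hμν : μ ≠ ν) :
    ‖((hol (avgIter L V j) z (plaqWord μ ν) : 𝔸ˣ) : 𝔸) - 1‖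
      ≤ transSum L V μ ν j z + 16 / 3 * C0 d * α₀ ^ 2 :=
  eq69_concrete L hL (avgClosed_unitaryUnits d L) j V hV hα hα3 hα2 h68 z hμν

end Unitary

section Matrices

open scoped Matrix.Norms.L2Operator

/-- **B10 (69) for `G = U(N)`, `N ≥ 1`, operator norm (19) of [4].** [cite: Balaban1985UV3, (68)–(69) p.273] -/
theorem eq69_unitaryGroup (N : ℕ) [NeZero N] (L : ℕ) (hL : 2 ≤ L) (j : ℕ)
    (V : Site d → Fin d → (Matrix (Fin N) (Fin N) ℂ)ˣ)
    (hV : ∀ x κ, V x κ ∈ unitaryUnits (Matrix (Fin N) (Fin N) ℂ)) {α₀ : ℝ} (hα : 0 < α₀)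
    (hα3 : C0 d * α₀ ≤ 1 / 3) (hα2 : 2 * α₀ ≤ c2' d L) (h68 : pdev V < α₀ * (((L : ℝ) ^ j)⁻¹) ^ 2)
    (z : Site d) {μ ν : Fin d} (hμν : μ ≠ ν) :
    ‖((hol (avgIter L V j) z (plaqWord μ ν) : (Matrix (Fin N) (Fin N) ℂ)ˣ) : Matrix (Fin N) (Fin N) ℂ) - 1‖
      ≤ transSum L V μ ν j z + 16 / 3 * C0 d * α₀ ^ 2 := by
  letI : CStarAlgebra (Matrix (Fin N) (Fin N) ℂ) := {}
  exact eq69_concrete L hL (avgClosed_unitaryUnits d L) j V hV hα hα3 hα2 h68 z hμν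

variable {n : Type*} [Fintype n] [DecidableEq n] [Nonempty n]

/-- **B10 (69) for `G = SU(N) ⊂ M_N(ℂ)`, operator norm** (Theorem 1 p. 257: "a semi-simple compact Lie group `G`");
the closure radius of `avgClosedAt_specialUnitary` costs the one `G`-dependent smallness `N·32(d+1)(d+4)L²α₀ < π`.
[cite: Balaban1985UV3, (68)–(69) p.273] -/
theorem eq69_specialUnitary (L : ℕ) (hL : 2 ≤ L) (j : ℕ) (V : Site d → Fin d → (Matrix n n ℂ)ˣ)
    (hV : ∀ x κ, V x κ ∈ specialUnitaryUnits n) {α₀ : ℝ} (hα : 0 < α₀) (hα3 : C0 d * α₀ ≤ 1 / 3)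
    (hα2 : 2 * α₀ ≤ c2' d L)
    (hαN : Fintype.card n * (32 * ((d : ℝ) + 1) * (d + 4) * (L : ℝ) ^ 2 * α₀) < Real.pi)
    (h68 : pdev V < α₀ * (((L : ℝ) ^ j)⁻¹) ^ 2) (z : Site d) {μ ν : Fin d} (hμν : μ ≠ ν) :
    ‖((hol (avgIter L V j) z (plaqWord μ ν) : (Matrix n n ℂ)ˣ) : Matrix n n ℂ) - 1‖
      ≤ transSum L V μ ν j z + 16 / 3 * C0 d * α₀ ^ 2 := by
  letI : CStarAlgebra (Matrix n n ℂ) := {}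
  have ht4 := radius_quarter (d := d) hL hα2
  exact eq69_at L hL (avgClosedAt_specialUnitary d L ht4 hαN) j V hV hα hα3 hα2 le_rfl h68 z hμν

end Matrices

/-! ## §2 (70), first inequality: "Squaring both sides" — Cauchy–Schwarz over the block and the fine plaquettes -/

section Squares

variable {𝔸 : Type*} [NormedRing 𝔸]

/-- `Σ_{p ⊂ (p′)_x} |U(∂p) − 1|²` over the `n²` unit plaquettes of the `n`-square at `x` (the inner sum of (70)).
[cite: Balaban1985UV3, (70) p.273] -/
def fineSumSq (n : ℕ) (V : Site d → Fin d → 𝔸ˣ) (x : Site d) (μ ν : Fin d) : ℝ :=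
  ∑ a ∈ Finset.range n, ∑ b ∈ Finset.range n,
    ‖((hol V (x + (a : ℤ) • e μ + (b : ℤ) • e ν) (plaqWord μ ν) : 𝔸ˣ) : 𝔸) - 1‖ ^ 2

/-- **The first sum of (70):** `Σ_{x∈B^j(x₀)} L^{(2−d)j} Σ_{p⊂(p′)_x} |U(∂p) − 1|²` (print, `d = 3`: weight `L^{−j}`;
`L^{(2−d)j} = L^{−dj}·(L^j)²` = the block weight of (69) × the `L^{2j}` fine plaquettes). [cite: Balaban1985UV3, (70) p.273] -/
def transSumSq (L : ℕ) (V : Site d → Fin d → 𝔸ˣ) (μ ν : Fin d) (j : ℕ) (z : Site d) : ℝ :=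
  ∑ r : Fin d → Fin (L ^ j), (((L : ℝ) ^ (d * j))⁻¹ * ((L : ℝ) ^ j) ^ 2) *
    fineSumSq (L ^ j) V (((L ^ j : ℕ) : ℤ) • z + boxVec (L ^ j) r) μ ν

/-- Cauchy–Schwarz over the `n²` fine plaquettes: `(Σ_p |U(∂p) − 1|)² ≤ n² Σ_p |U(∂p) − 1|²`. [folklore] -/
private theorem fineSum_sq_le (n : ℕ) (V : Site d → Fin d → 𝔸ˣ) (x : Site d) (μ ν : Fin d) :
    fineSum n V x μ ν ^ 2 ≤ (n : ℝ) ^ 2 * fineSumSq n V x μ ν := by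
  unfold fineSum fineSumSq
  calc _ ≤ #(Finset.range n) * ∑ a ∈ Finset.range n, (∑ b ∈ Finset.range n,
          ‖((hol V (x + (a : ℤ) • e μ + (b : ℤ) • e ν) (plaqWord μ ν) : 𝔸ˣ) : 𝔸) - 1‖) ^ 2 :=
        sq_sum_le_card_mul_sum_sq
    _ ≤ #(Finset.range n) * ∑ a ∈ Finset.range n, (#(Finset.range n) * ∑ b ∈ Finset.range n,
          ‖((hol V (x + (a : ℤ) • e μ + (b : ℤ) • e ν) (plaqWord μ ν) : 𝔸ˣ) : 𝔸) - 1‖ ^ 2) := by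
        gcongr with a _
        exact sq_sum_le_card_mul_sum_sq
    _ = _ := by rw [Finset.card_range, ← Finset.mul_sum]; ring

/-- **"Squaring both sides" of (69), the sum:** `(Σ_x L^{−dj} Σ_p |U(∂p) − 1|)² ≤ Σ_x L^{(2−d)j} Σ_p |U(∂p) − 1|²`
(Cauchy–Schwarz over the `L^{dj}` block points with the uniform weight, then over the `L^{2j}` fine plaquettes;
tacit in print — cell GAPS C-B10-2). [cite: Balaban1985UV3, (70) p.273] -/
theorem transSum_sq_le (L : ℕ) (hL : 1 ≤ L) (V : Site d → Fin d → 𝔸ˣ) (μ ν : Fin d) (j : ℕ) (z : Site d) :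
    transSum L V μ ν j z ^ 2 ≤ transSumSq L V μ ν j z := by
  have hL0 : (0 : ℝ) < L := by exact_mod_cast hL
  set n : ℕ := L ^ j with hn
  set w : ℝ := ((L : ℝ) ^ (d * j))⁻¹ with hw
  have hcard : (#(Finset.univ : Finset (Fin d → Fin n)) : ℝ) = (L : ℝ) ^ (d * j) := by
    rw [Finset.card_univ, Fintype.card_fun, Fintype.card_fin, Fintype.card_fin, hn]
    push_cast
    rw [← pow_mul, mul_comm]
  have hwN : w * (L : ℝ) ^ (d * j) = 1 := by rw [hw, inv_mul_cancel₀ (by positivity)]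
  have hw0 : 0 ≤ w := by positivity
  unfold transSum transSumN transSumSq
  rw [← hn, ← Finset.mul_sum, mul_pow]
  set F : (Fin d → Fin n) → ℝ := fun r => fineSum n V ((n : ℤ) • z + boxVec n r) μ ν with hF
  calc w ^ 2 * (∑ r, F r) ^ 2 ≤ w ^ 2 * (#(Finset.univ : Finset (Fin d → Fin n)) * ∑ r, F r ^ 2) :=
        mul_le_mul_of_nonneg_left sq_sum_le_card_mul_sum_sq (by positivity)
    _ = w * ∑ r, F r ^ 2 := by rw [hcard, ← mul_assoc, sq, mul_assoc w w, hwN, mul_one]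
    _ ≤ w * ∑ r, (n : ℝ) ^ 2 * fineSumSq n V ((n : ℤ) • z + boxVec n r) μ ν :=
        mul_le_mul_of_nonneg_left (Finset.sum_le_sum fun r _ => fineSum_sq_le n V _ μ ν) hw0
    _ = _ := by
        have hnr : (n : ℝ) = (L : ℝ) ^ j := by rw [hn, Nat.cast_pow]
        rw [Finset.mul_sum]
        refine Finset.sum_congr rfl fun r _ => ?_
        rw [hnr]; ring

variable [NormOneClass 𝔸]

/-- Under (68) `sup_p |U(∂p) − 1| < α₀L^{−2j}` the sum (69) is `≤ α₀` (each of the `L^{2j}` fine plaquettes of a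
translated big plaquette contributes `< α₀L^{−2j}`, and the block weights sum to `1`) — the `A = O(1)g_jp(g_j)` of
`B10.eq70_sq_step`. [cite: Balaban1985UV3, (68)–(70) p.273] -/
theorem transSum_le_of_pdev (L : ℕ) (hL : 1 ≤ L) {V : Site d → Fin d → 𝔸ˣ} (hV : ∀ x κ, V x κ ∈ U1 𝔸)
    (μ ν : Fin d) (j : ℕ) (z : Site d) {α₀ : ℝ} (h68 : pdev V ≤ α₀ * (((L : ℝ) ^ j)⁻¹) ^ 2) :
    transSum L V μ ν j z ≤ α₀ := by
  have hL0 : (0 : ℝ) < L := by exact_mod_cast hL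
  set n : ℕ := L ^ j with hn
  have hn1 : 1 ≤ n := Nat.one_le_pow _ _ hL
  have hnr : (n : ℝ) = (L : ℝ) ^ j := by rw [hn, Nat.cast_pow]
  have hfine : ∀ x, fineSum n V x μ ν ≤ α₀ := by
    intro x
    unfold fineSum
    calc _ ≤ ∑ _a ∈ Finset.range n, ∑ _b ∈ Finset.range n, α₀ * (((L : ℝ) ^ j)⁻¹) ^ 2 :=
          Finset.sum_le_sum fun a _ => Finset.sum_le_sum fun b _ => (le_pdev hV _ μ ν).trans h68
      _ = α₀ := by
          rw [Finset.sum_const, Finset.sum_const, Finset.card_range, nsmul_eq_mul, nsmul_eq_mul, hnr]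
          field_simp
  have hweights : ∑ _r : Fin d → Fin n, ((L : ℝ) ^ (d * j))⁻¹ = 1 := by
    have : ((L : ℝ) ^ (d * j))⁻¹ = (((n : ℝ)) ^ d)⁻¹ := by rw [hnr, ← pow_mul, mul_comm]
    rw [this]
    exact sum_weights n hn1
  unfold transSum transSumN
  rw [← hn]
  calc _ ≤ ∑ _r : Fin d → Fin n, ((L : ℝ) ^ (d * j))⁻¹ * α₀ :=
        Finset.sum_le_sum fun r _ => mul_le_mul_of_nonneg_left (hfine _) (by positivity)
    _ = α₀ := by rw [← Finset.sum_mul, hweights, one_mul]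

variable [NormedAlgebra ℂ 𝔸] [CompleteSpace 𝔸]

/-- **B10 (70), first inequality, kernel-checked for the concrete `j`-fold average:** *"Squaring both sides of the
above inequality and using (67) yields `|V_j(∂p′) − 1|² < Σ_{x∈B^j(x₀)} L^{−j} Σ_{p⊂(p′)_x} |U_k(∂p) − 1|² +
O(1)(g_jp(g_j))³`"* ((67): `Ū_k^j = V_j` on `Λ_j`).  Here, under the hypotheses of `eq69_at`:
`|Ū^j(∂p′) − 1|² ≤ Σ_{x∈B^j(x₀)} L^{(2−d)j} Σ_{p⊂(p′)_x} |U(∂p) − 1|² + (2α₀R + R²)`, `R = (16/3)C₀α₀²` (the printed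
`O(1)(g_jp(g_j))³`, explicit); squaring as in the tree's `B10.eq70_sq_step` with `s =` the sum (69) `≤ A = α₀`
(`transSum_le_of_pdev`), `b ≤ B = R`, and `s² ≤ Σ_x L^{(2−d)j} Σ_p |·|²` = `transSum_sq_le`. [cite: Balaban1985UV3, (70) p.273] -/
theorem eq70_first_at (L : ℕ) (hL : 2 ≤ L) {G : Subgroup 𝔸ˣ} {t : ℝ} (hG : AvgClosedAt d t L G) (j : ℕ)
    (V : Site d → Fin d → 𝔸ˣ) (hV : ∀ x κ, V x κ ∈ G) {α₀ : ℝ} (hα : 0 < α₀)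
    (hα3 : C0 d * α₀ ≤ 1 / 3) (hα2 : 2 * α₀ ≤ c2' d L)
    (hαt : 32 * ((d : ℝ) + 1) * (d + 4) * (L : ℝ) ^ 2 * α₀ ≤ t)
    (h68 : pdev V < α₀ * (((L : ℝ) ^ j)⁻¹) ^ 2) (z : Site d) {μ ν : Fin d} (hμν : μ ≠ ν) :
    ‖((hol (avgIter L V j) z (plaqWord μ ν) : 𝔸ˣ) : 𝔸) - 1‖ ^ 2
      ≤ transSumSq L V μ ν j z +
        (2 * α₀ * (16 / 3 * C0 d * α₀ ^ 2) + (16 / 3 * C0 d * α₀ ^ 2) ^ 2) := by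
  have hL1 : 1 ≤ L := le_trans (by norm_num) hL
  have hU : ∀ x κ, V x κ ∈ U1 𝔸 := fun x κ => hG.le_U1 (hV x κ)
  set s := transSum L V μ ν j z with hs
  set R : ℝ := 16 / 3 * C0 d * α₀ ^ 2 with hR
  have h69 := eq69_at L hL hG j V hV hα hα3 hα2 hαt h68 z hμν
  have hs0 : 0 ≤ s := transSum_nonneg L V μ ν j z
  have hsA : s ≤ α₀ := transSum_le_of_pdev L hL1 hU μ ν j z h68.le
  have hR0 : 0 ≤ R := by have := C0_pos d; positivity
  have hsq : ‖((hol (avgIter L V j) z (plaqWord μ ν) : 𝔸ˣ) : 𝔸) - 1‖ ^ 2 ≤ (s + R) ^ 2 :=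
    pow_le_pow_left₀ (norm_nonneg _) h69 2
  have hstep : (s + R) ^ 2 ≤ s ^ 2 + (2 * α₀ * R + R ^ 2) := by
    nlinarith [mul_le_mul_of_nonneg_right hsA hR0]
  exact hsq.trans (hstep.trans (add_le_add (transSum_sq_le L hL1 V μ ν j z) le_rfl))

end Squares

/-! ## §2b The second sum of (70): the `Δ′`-count -/

section Region

variable {𝔸 : Type*} [NormedRing 𝔸]

/-- The lower-left corners, relative to `x₀`, of the unit plaquettes in the `μν`-orientation contained in `Δ′ =
B^j(x₀) ∪ B^j(y₀) ∪ B^j(z₀) ∪ B^j(w₀)` (the `2 × 2` arrangement of `j`-blocks spanned by `p′ = ⟨x₀, y₀, z₀, w₀⟩`, side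
`n = L^j`): offsets `v` with `v_μ, v_ν ≤ 2n − 2` and `v_κ < n` otherwise. [cite: Balaban1985UV3, (70) p.273] -/
def regionBox (d n : ℕ) (μ ν : Fin d) : Finset (Fin d → ℕ) :=
  Fintype.piFinset fun κ => if κ = μ ∨ κ = ν then Finset.range (2 * n - 1) else Finset.range n

/-- `Σ_{p ⊂ Δ′} |U(∂p) − 1|²` over the unit plaquettes `p` in the orientation of `p′` contained in `Δ′` (the second
sum of (70), before the trace normalization (11)). [cite: Balaban1985UV3, (70) p.273] -/
def regionSumSq (n : ℕ) (V : Site d → Fin d → 𝔸ˣ) (x₀ : Site d) (μ ν : Fin d) : ℝ :=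
  ∑ v ∈ regionBox d n μ ν, ‖((hol V (x₀ + fun κ => (v κ : ℤ)) (plaqWord μ ν) : 𝔸ˣ) : 𝔸) - 1‖ ^ 2

/-- The offset of the fine plaquette `(x₀ + r + a e_μ + b e_ν; μ, ν)` in `ℕ^d`. [folklore] -/
private def offs (n : ℕ) (μ ν : Fin d) (a b : ℕ) (r : Fin d → Fin n) : Fin d → ℕ :=
  fun κ => (r κ : ℕ) + (if κ = μ then a else 0) + (if κ = ν then b else 0)

/-- The fine-plaquette base point via its `ℕ^d` offset. [folklore] -/
private theorem offs_cast (n : ℕ) (μ ν : Fin d) (a b : ℕ) (r : Fin d → Fin n) (x₀ : Site d) :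
    x₀ + boxVec n r + (a : ℤ) • e μ + (b : ℤ) • e ν = x₀ + fun κ => ((offs n μ ν a b r κ : ℕ) : ℤ) := by
  funext κ
  simp only [offs, boxVec, Pi.add_apply, Pi.smul_apply, e_apply, smul_eq_mul, mul_ite, mul_one, mul_zero]
  push_cast
  ring

/-- For fixed `(a, b)` the offset determines `r`. [folklore] -/
private theorem offs_injective (n : ℕ) (μ ν : Fin d) (a b : ℕ) : Function.Injective (offs n μ ν a b) := by
  intro r r' h
  funext κ
  have hκ := congr_fun h κ
  simp only [offs] at hκ
  exact Fin.ext (by omega)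

/-- The offsets lie in `Δ′` (relative coordinates), for `μ ≠ ν`. [folklore] -/
private theorem offs_mem (n : ℕ) {μ ν : Fin d} (hμν : μ ≠ ν) {a b : ℕ} (ha : a < n) (hb : b < n)
    (r : Fin d → Fin n) : offs n μ ν a b r ∈ regionBox d n μ ν := by
  rw [regionBox, Fintype.mem_piFinset]
  intro κ
  have hr := (r κ).isLt
  simp only [offs]
  by_cases hκμ : κ = μ
  · subst hκμ
    simp only [if_true, true_or, if_neg hμν, Finset.mem_range]
    omega
  · by_cases hκν : κ = ν
    · subst hκν
      simp only [if_neg hκμ, if_true, or_true, Finset.mem_range]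
      omega
    · simp only [hκμ, hκν, or_self, if_false, Finset.mem_range]
      omega

/-- **The count behind the second inequality of (70):** each fine plaquette of `Δ′` lies in at most `n²` translates
`(p′)_x`, `x ∈ B^j(x₀)`, so `Σ_{x∈B^j(x₀)} Σ_{p⊂(p′)_x} |U(∂p) − 1|² ≤ n² Σ_{p⊂Δ′} |U(∂p) − 1|²` (for each of the `n²`
positions `(a, b)` of a fine plaquette inside a big one, `x ↦ p` is injective into `Δ′`). [cite: Balaban1985UV3, (70) p.273] -/
theorem sum_fineSumSq_le (n : ℕ) (V : Site d → Fin d → 𝔸ˣ) (x₀ : Site d) {μ ν : Fin d} (hμν : μ ≠ ν) :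
    ∑ r : Fin d → Fin n, fineSumSq n V (x₀ + boxVec n r) μ ν ≤ (n : ℝ) ^ 2 * regionSumSq n V x₀ μ ν := by
  classical
  set G : (Fin d → ℕ) → ℝ := fun v => ‖((hol V (x₀ + fun κ => (v κ : ℤ)) (plaqWord μ ν) : 𝔸ˣ) : 𝔸) - 1‖ ^ 2
    with hG
  have hG0 : ∀ v, 0 ≤ G v := fun v => by positivity
  have hfix : ∀ a ∈ Finset.range n, ∀ b ∈ Finset.range n,
      ∑ r : Fin d → Fin n, G (offs n μ ν a b r) ≤ regionSumSq n V x₀ μ ν := by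
    intro a ha b hb
    rw [Finset.mem_range] at ha hb
    rw [← Finset.sum_image fun r _ r' _ h => offs_injective n μ ν a b h]
    exact Finset.sum_le_sum_of_subset_of_nonneg
      (fun v hv => by
        obtain ⟨r, -, rfl⟩ := Finset.mem_image.mp hv
        exact offs_mem n hμν ha hb r)
      (fun v _ _ => hG0 v)
  unfold fineSumSq
  calc _ = ∑ r : Fin d → Fin n, ∑ a ∈ Finset.range n, ∑ b ∈ Finset.range n, G (offs n μ ν a b r) := by
        refine Finset.sum_congr rfl fun r _ => Finset.sum_congr rfl fun a _ => Finset.sum_congr rfl fun b _ => ?_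
        rw [hG, offs_cast]
    _ = ∑ a ∈ Finset.range n, ∑ b ∈ Finset.range n, ∑ r : Fin d → Fin n, G (offs n μ ν a b r) := by
        rw [Finset.sum_comm]
        exact Finset.sum_congr rfl fun a _ => Finset.sum_comm
    _ ≤ ∑ _a ∈ Finset.range n, ∑ _b ∈ Finset.range n, regionSumSq n V x₀ μ ν :=
        Finset.sum_le_sum fun a ha => Finset.sum_le_sum fun b hb => hfix a ha b hb
    _ = (n : ℝ) ^ 2 * regionSumSq n V x₀ μ ν := by
        rw [Finset.sum_const, Finset.sum_const, Finset.card_range, nsmul_eq_mul, nsmul_eq_mul]; ring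

/-- **(70), the first sum bounded by the `Δ′`-sum:** `Σ_{x∈B^j(x₀)} L^{(2−d)j} Σ_{p⊂(p′)_x} |U(∂p) − 1|² ≤
L^{(4−d)j} Σ_{p⊂Δ′} |U(∂p) − 1|²` (print, `d = 3`: "`≤ 2Σ_{p⊂Δ′} L^j[1 − Re tr U_k(∂p)]`" — the factor `L^j = L^{(4−3)j}`
is this count; the remaining identity `|U − 1|² = 2[1 − Re tr U]` is the trace normalization (11) p. 258, row B10.Eq11,
not used here). [cite: Balaban1985UV3, (70) p.273] -/
theorem transSumSq_le_region (L : ℕ) (hL : 1 ≤ L) (V : Site d → Fin d → 𝔸ˣ) {μ ν : Fin d} (hμν : μ ≠ ν) (j : ℕ)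
    (z : Site d) :
    transSumSq L V μ ν j z ≤ ((L : ℝ) ^ (d * j))⁻¹ * ((L : ℝ) ^ j) ^ 4 *
      regionSumSq (L ^ j) V (((L ^ j : ℕ) : ℤ) • z) μ ν := by
  have hL0 : (0 : ℝ) < L := by exact_mod_cast hL
  have hnr : ((L ^ j : ℕ) : ℝ) = (L : ℝ) ^ j := by rw [Nat.cast_pow]
  unfold transSumSq
  rw [← Finset.mul_sum]
  have h := sum_fineSumSq_le (L ^ j) V (((L ^ j : ℕ) : ℤ) • z) hμν
  rw [hnr] at h
  calc _ ≤ ((L : ℝ) ^ (d * j))⁻¹ * ((L : ℝ) ^ j) ^ 2 * (((L : ℝ) ^ j) ^ 2 * regionSumSq (L ^ j) V _ μ ν) :=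
        mul_le_mul_of_nonneg_left h (by positivity)
    _ = _ := by ring

end Region

section RegionBound

variable {𝔸 : Type*} [NormedRing 𝔸] [NormOneClass 𝔸] [NormedAlgebra ℂ 𝔸] [CompleteSpace 𝔸]

/-- **(70) up to the trace normalization:** under the hypotheses of `B10Eq69Concrete.eq69_at`,
`|Ū^j(∂p′) − 1|² ≤ L^{(4−d)j} Σ_{p⊂Δ′} |U(∂p) − 1|² + (2α₀R + R²)`, `R = (16/3)C₀α₀²` — both printed inequalities
of (70) except the identity `|U − 1|² = 2[1 − Re tr U]` of (11) (row B10.Eq11), with `d` general (`L^{(4−d)j}` written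
`L^{−dj}(L^j)⁴`; print, `d = 3`: `L^j`) and the `O(1)(g_jp(g_j))³` explicit. [cite: Balaban1985UV3, (70) p.273] -/
theorem eq70_region_at (L : ℕ) (hL : 2 ≤ L) {G : Subgroup 𝔸ˣ} {t : ℝ} (hG : AvgClosedAt d t L G) (j : ℕ)
    (V : Site d → Fin d → 𝔸ˣ) (hV : ∀ x κ, V x κ ∈ G) {α₀ : ℝ} (hα : 0 < α₀)
    (hα3 : C0 d * α₀ ≤ 1 / 3) (hα2 : 2 * α₀ ≤ c2' d L)
    (hαt : 32 * ((d : ℝ) + 1) * (d + 4) * (L : ℝ) ^ 2 * α₀ ≤ t)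
    (h68 : pdev V < α₀ * (((L : ℝ) ^ j)⁻¹) ^ 2) (z : Site d) {μ ν : Fin d} (hμν : μ ≠ ν) :
    ‖((hol (avgIter L V j) z (plaqWord μ ν) : 𝔸ˣ) : 𝔸) - 1‖ ^ 2
      ≤ ((L : ℝ) ^ (d * j))⁻¹ * ((L : ℝ) ^ j) ^ 4 * regionSumSq (L ^ j) V (((L ^ j : ℕ) : ℤ) • z) μ ν +
        (2 * α₀ * (16 / 3 * C0 d * α₀ ^ 2) + (16 / 3 * C0 d * α₀ ^ 2) ^ 2) :=
  (eq70_first_at L hL hG j V hV hα hα3 hα2 hαt h68 z hμν).trans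
    (add_le_add (transSumSq_le_region L (le_trans (by norm_num) hL) V hμν j z) le_rfl)

end RegionBound

/-! ## §3 (70), first inequality, for `U(N)` and `SU(N)` -/

section Matrices70

open scoped Matrix.Norms.L2Operator

/-- **(70), first inequality, for `G = U(N)`, `N ≥ 1`, operator norm.** [cite: Balaban1985UV3, (70) p.273] -/
theorem eq70_first_unitaryGroup (N : ℕ) [NeZero N] (L : ℕ) (hL : 2 ≤ L) (j : ℕ)
    (V : Site d → Fin d → (Matrix (Fin N) (Fin N) ℂ)ˣ)
    (hV : ∀ x κ, V x κ ∈ unitaryUnits (Matrix (Fin N) (Fin N) ℂ)) {α₀ : ℝ} (hα : 0 < α₀)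
    (hα3 : C0 d * α₀ ≤ 1 / 3) (hα2 : 2 * α₀ ≤ c2' d L) (h68 : pdev V < α₀ * (((L : ℝ) ^ j)⁻¹) ^ 2)
    (z : Site d) {μ ν : Fin d} (hμν : μ ≠ ν) :
    ‖((hol (avgIter L V j) z (plaqWord μ ν) : (Matrix (Fin N) (Fin N) ℂ)ˣ) : Matrix (Fin N) (Fin N) ℂ) - 1‖ ^ 2
      ≤ transSumSq L V μ ν j z +
        (2 * α₀ * (16 / 3 * C0 d * α₀ ^ 2) + (16 / 3 * C0 d * α₀ ^ 2) ^ 2) := by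
  letI : CStarAlgebra (Matrix (Fin N) (Fin N) ℂ) := {}
  have ht := radius_quarter (d := d) hL hα2
  exact eq70_first_at L hL (avgClosedAt_of_avgClosed (avgClosed_unitaryUnits d L) le_rfl) j V hV hα hα3 hα2 ht
    h68 z hμν

variable {n : Type*} [Fintype n] [DecidableEq n] [Nonempty n]

/-- **(70), first inequality, for `G = SU(N)`** (one `G`-dependent smallness `N·32(d+1)(d+4)L²α₀ < π`).
[cite: Balaban1985UV3, (70) p.273] -/
theorem eq70_first_specialUnitary (L : ℕ) (hL : 2 ≤ L) (j : ℕ) (V : Site d → Fin d → (Matrix n n ℂ)ˣ)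
    (hV : ∀ x κ, V x κ ∈ specialUnitaryUnits n) {α₀ : ℝ} (hα : 0 < α₀) (hα3 : C0 d * α₀ ≤ 1 / 3)
    (hα2 : 2 * α₀ ≤ c2' d L)
    (hαN : Fintype.card n * (32 * ((d : ℝ) + 1) * (d + 4) * (L : ℝ) ^ 2 * α₀) < Real.pi)
    (h68 : pdev V < α₀ * (((L : ℝ) ^ j)⁻¹) ^ 2) (z : Site d) {μ ν : Fin d} (hμν : μ ≠ ν) :
    ‖((hol (avgIter L V j) z (plaqWord μ ν) : (Matrix n n ℂ)ˣ) : Matrix n n ℂ) - 1‖ ^ 2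
      ≤ transSumSq L V μ ν j z +
        (2 * α₀ * (16 / 3 * C0 d * α₀ ^ 2) + (16 / 3 * C0 d * α₀ ^ 2) ^ 2) := by
  letI : CStarAlgebra (Matrix n n ℂ) := {}
  have ht4 := radius_quarter (d := d) hL hα2
  exact eq70_first_at L hL (avgClosedAt_specialUnitary d L ht4 hαN) j V hV hα hα3 hα2 le_rfl h68 z hμν

end Matrices70

end Literature.MathematicalPhysics.QuantumFieldTheory.Balaban1983to89.B10Eq70Concrete
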